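import Literature.Analysis.FluidPDE.KatoLaiAbstractEvolutionProofs
import Mathlib.Analysis.InnerProductSpace.Adjoint
import Mathlib.Analysis.InnerProductSpace.Dual
import HarnessLib

/-!
# Kato–Lai 1984, Theorem A on the canonical triplet `V ⊂ H ⊂ V*` (duality form)

Topic `Literature/Analysis/FluidPDE`. Source: T. Kato, C. Y. Lai, *Nonlinear evolution equations
and the Euler flow*, J. Funct. Anal. **56** (1984) 15–28, §3, p. 18: "Our admissible triplet is
similar to a 'canonical triplet' `V ⊂ H ⊂ V*` widely used"; Thm A (p. 18). The tree proves Thm A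
for every admissible triplet `{V, H, X}` (`Literature.Analysis.FluidPDE.KatoLai1984_thmA_holds`,
`KatoLaiAbstractEvolutionProofs.lean`). This file records the canonical instance and the
resulting **duality form** of Thm A, which is the form in which the theorem is applied to partial
differential operators given through their energy (bilinear) form rather than as maps into a
third space `X`:

* `KatoLai.AdmissibleTriplet.ofDenseInclusion i hi hd : AdmissibleTriplet V H V` — for real Hilbert
  spaces `V`, `H` and an injective continuous linear map `i : V → H` with dense range, the triplet
  `{V, H, V}` whose second inclusion `H → V` is the Hilbert-space ADJOINT `i†` of `i` (the Riesz
  picture of `H ≅ H* ⊂ V*`) and whose pairing is the inner product of `V`: (3.1) reads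
  `⟪v, i† u⟫_V = ⟪i v, u⟫_H`; `i†` is injective because `range i` is dense
  (`(range i)ᗮ = ker i†`) and has dense range because `i` is injective
  (`(ker i)ᗮ = closure (range i†)`); nondegeneracy is that of the inner product. No choice of a
  space `X` and no separate nondegeneracy argument are needed;
* `KatoLai.IsSeqWeaklyContinuousFormOn`, `KatoLai.IsFormSolution` — weak sequential continuity
  and the solution class (3.3) for an operator given as a time-dependent family of continuous
  linear functionals `B t u ∈ V*` (`B : ℝ → H → V →L[ℝ] ℝ`, "`⟨v, A(t, u)⟩ = B t u v`"): the
  equation is `d/dt ⟪i v, u(t)⟫_H = -B t (u t) v` for every `v ∈ V`;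
* `KatoLai.thmA_form`, `KatoLai.thmA_form_exists` — **Thm A in duality form**: if `B` is
  sequentially weakly continuous on `I_{T₀} × H` (tested against every `v ∈ V`) and
  `B t (i v) v ≥ -β(‖i v‖²_H)` for `v ∈ V`, `β ≥ 0` monotone, then for every `φ ∈ H`, every
  `T ∈ (0, T₀]` and every strict supersolution `p` of `p' = 2β(p)` with `p(0) ≥ ‖φ‖²` there is a
  weakly continuous `u : I_T → H`, `u(0) = φ`, solving the equation against every `v ∈ V`, with
  `‖u(t)‖² ≤ p(t)`; and the printed "there is `T > 0`" corollary. Proof: Thm A for the canonical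
  triplet and the `V`-valued operator `A t u = R⁻¹(B t u)`, `R : V ≃ V*` the Riesz isometry
  (`InnerProductSpace.toDual`), for which `⟪v, A t u⟫_V = B t u v`.

Purpose. This is layer 0 of the energy-method (Galerkin) route to the one analytic input still
missing below `Literature.Geometry.Riemannian.ricciFlow_shortTime_existence` (Hamilton 1982,
Thm. 4.2), namely the hypothesis `hQL` of
`Literature.Geometry.Riemannian.ricciFlow_shortTime_existence_of_quasilinear`
(`Geometry/Riemannian/RicciDeTurckShortTime.lean`): short-time existence for quasilinear strictly
parabolic second-order systems on a closed manifold (Hamilton 1982, §5, pp. 262–263;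
Mantegazza–Martinazzi 2012, Thm. 1.1; Taylor, *PDE III*, Ch. 15, §7). On that route `H` is a
Sobolev space `H^s(M; W)` of high order built from finitely many charts, `V = H^{s+2}(M; W)`,
`B t u v = (v, -P u)_{H^s}` is the localized energy form of the operator, the coercivity
hypothesis is Gårding's inequality at level `s`, weak continuity comes from Rellich's lemma, and
the present file supplies the abstract existence step with no third space to construct.
Everything here is proved; no named fact and no `sorry` is introduced.

Mathlib: `ContinuousLinearMap.adjoint` (`adjoint_inner_left/right`, `orthogonal_range`,
`orthogonal_ker`), `Submodule.topologicalClosure_eq_top_iff`,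
`Submodule.dense_iff_topologicalClosure_eq_top`, `InnerProductSpace.toDual`
(`toDual_symm_apply`), `innerSL`.

## References

* T. Kato, C. Y. Lai, *Nonlinear evolution equations and the Euler flow*, J. Funct. Anal. 56
  (1984) 15–28, §3, p. 18 (admissible and canonical triplets), Thm A. [KatoLai1984]
* J.-L. Lions, *Quelques méthodes de résolution des problèmes aux limites non linéaires*, Dunod
  1969, Ch. 1, §1 (the setting `V ⊂ H ⊂ V'`). [Lions1969]
-/

noncomputable section

open Set Filter Topology
open scoped RealInnerProductSpace InnerProduct

namespace Literature.Analysis.FluidPDE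

namespace KatoLai

universe u v

variable {V : Type u} {H : Type v} [NormedAddCommGroup V] [InnerProductSpace ℝ V]

/-! ### The adjoint of a dense injective inclusion -/

section Adjoint

variable [NormedAddCommGroup H] [InnerProductSpace ℝ H] [CompleteSpace V] [CompleteSpace H]

/-- If `i : V → H` has dense range then its adjoint `i† : H → V` is injective:
`ker i† = (range i)ᗮ = ⊥`. [folklore] -/
theorem adjoint_injective_of_denseRange (i : V →L[ℝ] H) (hd : DenseRange i) :
    Function.Injective (i†) := by
  have hcl : (LinearMap.range (i : V →ₗ[ℝ] H)).topologicalClosure = ⊤ := by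
    rw [← Submodule.dense_iff_topologicalClosure_eq_top]
    simpa [LinearMap.coe_range, DenseRange, ContinuousLinearMap.coe_coe] using hd
  have hker : LinearMap.ker ((i†) : H →ₗ[ℝ] V) = ⊥ := by
    rw [← ContinuousLinearMap.orthogonal_range, ← Submodule.topologicalClosure_eq_top_iff]
    exact hcl
  intro x y hxy
  exact LinearMap.ker_eq_bot.1 hker hxy

/-- If `i : V → H` is injective then its adjoint `i† : H → V` has dense range:
`closure (range i†) = (ker i)ᗮ = ⊤`. [folklore] -/
theorem denseRange_adjoint_of_injective (i : V →L[ℝ] H) (hi : Function.Injective i) :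
    DenseRange (i†) := by
  have hker : LinearMap.ker (i : V →ₗ[ℝ] H) = ⊥ := LinearMap.ker_eq_bot.2 fun x y hxy => hi hxy
  have hcl : (LinearMap.range ((i†) : H →ₗ[ℝ] V)).topologicalClosure = ⊤ := by
    rw [← ContinuousLinearMap.orthogonal_ker, hker, Submodule.bot_orthogonal_eq_top]
  have hdense : Dense ((LinearMap.range ((i†) : H →ₗ[ℝ] V) : Submodule ℝ V) : Set V) :=
    Submodule.dense_iff_topologicalClosure_eq_top.2 hcl
  simpa [DenseRange, LinearMap.coe_range, ContinuousLinearMap.coe_coe] using hdense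

/-- **The canonical triplet `V ⊂ H ⊂ V*` in Riesz form** (Kato–Lai 1984, §3, p. 18: "similar to a
'canonical triplet' `V ⊂ H ⊂ V*` widely used"; Lions 1969, Ch. 1, §1): for real Hilbert spaces
`V`, `H` and an injective continuous linear `i : V → H` with dense range, `{V, H, V}` is an
admissible triplet with second inclusion the adjoint `i† : H → V` (i.e. `H ≅ H* → V* ≅ V`) and
pairing the inner product of `V`; (3.1) is `⟪v, i† u⟫_V = ⟪i v, u⟫_H`.
[cite: KatoLai1984, §3 (p. 18), admissible triplet and the remark on the canonical triplet] -/
def AdmissibleTriplet.ofDenseInclusion (i : V →L[ℝ] H) (hi : Function.Injective i)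
    (hd : DenseRange i) : AdmissibleTriplet V H V where
  inclVH := i
  inclHX := i†
  injective_inclVH := hi
  denseRange_inclVH := hd
  injective_inclHX := adjoint_injective_of_denseRange i hd
  denseRange_inclHX := denseRange_adjoint_of_injective i hi
  pairing := innerSL ℝ
  pairing_inclHX v u := by
    rw [innerSL_apply_apply, ContinuousLinearMap.adjoint_inner_right]
  pairing_nondegenerate f hf := by
    have h := hf f
    rwa [innerSL_apply_apply, real_inner_self_eq_norm_sq, sq_eq_zero_iff, norm_eq_zero] at h

/-- The first inclusion of the canonical triplet is `i`. [cite: KatoLai1984, §3 (p. 18)] -/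
@[simp]
theorem AdmissibleTriplet.ofDenseInclusion_inclVH (i : V →L[ℝ] H) (hi : Function.Injective i)
    (hd : DenseRange i) : (AdmissibleTriplet.ofDenseInclusion i hi hd).inclVH = i := rfl

/-- The second inclusion of the canonical triplet is the adjoint `i†`.
[cite: KatoLai1984, §3 (p. 18)] -/
@[simp]
theorem AdmissibleTriplet.ofDenseInclusion_inclHX (i : V →L[ℝ] H) (hi : Function.Injective i)
    (hd : DenseRange i) : (AdmissibleTriplet.ofDenseInclusion i hi hd).inclHX = i† := rfl

/-- The pairing of the canonical triplet is the inner product of `V`.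
[cite: KatoLai1984, §3 (p. 18)] -/
@[simp]
theorem AdmissibleTriplet.ofDenseInclusion_pairing (i : V →L[ℝ] H) (hi : Function.Injective i)
    (hd : DenseRange i) (v f : V) :
    (AdmissibleTriplet.ofDenseInclusion i hi hd).pairing v f = ⟪v, f⟫ := rfl

end Adjoint

/-! ### Operators in duality form -/

section Form

variable [NormedAddCommGroup H] [InnerProductSpace ℝ H]

/-- **Sequential weak continuity of an operator in duality form** `B : I × H → V*`
(`B t u v = ⟨v, A(t, u)⟩`; Kato–Lai 1984, Thm A: "a (sequentially) weakly continuous map on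
`I_{T₀} × H`"): `tₙ → t` within `S` and `wₙ ⇀ w` weakly in `H` imply `B tₙ wₙ v → B t w v` for
every `v ∈ V` (weak-* convergence in `V*` tested against `V`; for the Riesz-identified `V`-valued
operator this is weak convergence, `isSeqWeaklyContinuousOn_riesz`).
[cite: KatoLai1984, §3 Thm A (p. 18)] -/
def IsSeqWeaklyContinuousFormOn (S : Set ℝ) (B : ℝ → H → V →L[ℝ] ℝ) : Prop :=
  ∀ (t : ℕ → ℝ) (t' : ℝ) (w : ℕ → H) (w' : H), (∀ n, t n ∈ S) → t' ∈ S →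
    Tendsto t atTop (𝓝 t') → (∀ h : H, Tendsto (fun n => ⟪h, w n⟫) atTop (𝓝 ⟪h, w'⟫)) →
    ∀ v : V, Tendsto (fun n => B (t n) (w n) v) atTop (𝓝 (B t' w' v))

/-- Weak sequential continuity in duality form is inherited by smaller time sets.
[cite: KatoLai1984, §3 Thm A (p. 18)] -/
theorem IsSeqWeaklyContinuousFormOn.mono {S S' : Set ℝ} {B : ℝ → H → V →L[ℝ] ℝ}
    (hB : IsSeqWeaklyContinuousFormOn S B) (hS : S' ⊆ S) : IsSeqWeaklyContinuousFormOn S' B :=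
  fun t t' w w' ht ht' => hB t t' w w' (fun n => hS (ht n)) (hS ht')

/-- **Solutions in duality form** on `I_T = [0, T]` (Kato–Lai 1984, (A) and (3.3), in the form
proved on p. 27, for the canonical triplet): `u(0) = φ`; `u ∈ C_w(I_T; H)`; for every `v ∈ V`
the function `t ↦ ⟪i v, u(t)⟫_H` has derivative `-B t (u t) v` within `I_T` at every `t ∈ I_T`
("`dₜu + A(t, u) = 0` in `V*`"), and this derivative is continuous on `I_T`.
[cite: KatoLai1984, §3 Thm A (p. 18), (A) and (3.3)] -/
structure IsFormSolution (i : V →L[ℝ] H) (B : ℝ → H → V →L[ℝ] ℝ) (φ : H) (T : ℝ)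
    (u : ℝ → H) : Prop where
  /-- The initial condition `u(0) = φ`. -/
  initial : u 0 = φ
  /-- `u ∈ C_w(I_T; H)`. -/
  continuousOn_inner : ∀ h : H, ContinuousOn (fun t => ⟪h, u t⟫) (Icc 0 T)
  /-- The equation `dₜ ⟪i v, u⟫_H = -B t (u t) v` on `I_T`, for every `v ∈ V`. -/
  hasDerivWithinAt : ∀ v : V, ∀ t ∈ Icc 0 T,
    HasDerivWithinAt (fun s => ⟪i v, u s⟫) (-(B t (u t) v)) (Icc 0 T) t
  /-- `dₜu ∈ C_w(I_T; V*)` tested against `V`. -/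
  continuousOn_form : ∀ v : V, ContinuousOn (fun t => B t (u t) v) (Icc 0 T)

/-- For a time-independent operator in duality form, weak sequential continuity reduces to:
`wₙ ⇀ w` weakly in `H` implies `B wₙ v → B w v` for every `v ∈ V`. [folklore] -/
theorem isSeqWeaklyContinuousFormOn_const {S : Set ℝ} {B₀ : H → V →L[ℝ] ℝ}
    (hB : ∀ (w : ℕ → H) (w' : H), (∀ h : H, Tendsto (fun n => ⟪h, w n⟫) atTop (𝓝 ⟪h, w'⟫)) →
      ∀ v : V, Tendsto (fun n => B₀ (w n) v) atTop (𝓝 (B₀ w' v))) :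
    IsSeqWeaklyContinuousFormOn S (fun _ : ℝ => B₀) :=
  fun _ _ w w' _ _ _ hw v => hB w w' hw v

end Form

section Riesz

variable [CompleteSpace V]

/-- The `V`-valued operator attached to a duality-form operator by the Riesz isometry
`R : V ≃ V*` (`InnerProductSpace.toDual`): `riesz B t u = R⁻¹ (B t u)`, so that
`⟪v, riesz B t u⟫_V = B t u v`. [folklore] -/
def riesz (B : ℝ → H → V →L[ℝ] ℝ) (t : ℝ) (u : H) : V :=
  (InnerProductSpace.toDual ℝ V).symm (B t u)

/-- `⟪v, riesz B t u⟫_V = B t u v`. [folklore] -/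
@[simp]
theorem inner_riesz (B : ℝ → H → V →L[ℝ] ℝ) (t : ℝ) (u : H) (v : V) :
    ⟪v, riesz B t u⟫ = B t u v := by
  rw [riesz, real_inner_comm, InnerProductSpace.toDual_symm_apply]

/-- A continuous linear functional on the Hilbert space `V` is `⟪R⁻¹ ℓ, ·⟫`. [folklore] -/
theorem dual_apply_eq_inner (ℓ : StrongDual ℝ V) (x : V) :
    ℓ x = ⟪(InnerProductSpace.toDual ℝ V).symm ℓ, x⟫ := by
  rw [InnerProductSpace.toDual_symm_apply]

end Riesz

section RieszWeak

variable [NormedAddCommGroup H] [InnerProductSpace ℝ H] [CompleteSpace V]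

/-- Weak sequential continuity in duality form is weak sequential continuity of the
Riesz-identified `V`-valued operator (every `ℓ ∈ V*` is `⟪R⁻¹ℓ, ·⟫`).
[cite: KatoLai1984, §3 Thm A (p. 18)] -/
theorem isSeqWeaklyContinuousOn_riesz {S : Set ℝ} {B : ℝ → H → V →L[ℝ] ℝ}
    (hB : IsSeqWeaklyContinuousFormOn S B) : IsSeqWeaklyContinuousOn S (riesz B) := by
  intro t t' w w' ht ht' htt hw ℓ
  have key : ∀ (s : ℝ) (x : H),
      ℓ (riesz B s x) = B s x ((InnerProductSpace.toDual ℝ V).symm ℓ) := fun s x => by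
    rw [dual_apply_eq_inner, inner_riesz]
  simp_rw [key]
  exact hB t t' w w' ht ht' htt hw _

end RieszWeak

/-! ### Theorem A in duality form -/

section ThmA

variable [NormedAddCommGroup H] [InnerProductSpace ℝ H] [CompleteSpace V] [CompleteSpace H]

/-- A solution for the canonical triplet and the Riesz-identified operator is a solution in
duality form. [cite: KatoLai1984, §3 Thm A (p. 18)] -/
theorem IsFormSolution.of_isSolution {i : V →L[ℝ] H} (hi : Function.Injective i)
    (hd : DenseRange i) {B : ℝ → H → V →L[ℝ] ℝ} {φ : H} {T : ℝ} {u : ℝ → H}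
    (hu : IsSolution (AdmissibleTriplet.ofDenseInclusion i hi hd) (riesz B) φ T u) :
    IsFormSolution i B φ T u where
  initial := hu.initial
  continuousOn_inner := hu.continuousOn_inner
  hasDerivWithinAt v t ht := by
    have h := hu.hasDerivWithinAt v t ht
    simp only [AdmissibleTriplet.ofDenseInclusion_pairing, AdmissibleTriplet.ofDenseInclusion_inclHX,
      ContinuousLinearMap.adjoint_inner_right, inner_riesz] at h
    exact h
  continuousOn_form v := by
    have h := hu.continuousOn_pairing_A v
    simp only [AdmissibleTriplet.ofDenseInclusion_pairing, inner_riesz] at h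
    exact h

variable [TopologicalSpace.SeparableSpace V] [TopologicalSpace.SeparableSpace H]

/-- **Kato–Lai 1984, Theorem A in duality form (canonical triplet `V ⊂ H ⊂ V*`)**, supersolution
form of (3.4)–(3.5): let `V`, `H` be real separable Hilbert spaces, `i : V → H` injective,
continuous, linear with dense range; let `B : I_{T₀} × H → V*` be sequentially weakly continuous
(`IsSeqWeaklyContinuousFormOn`) with `B t (i v) v ≥ -β(‖i v‖²_H)` for `t ∈ I_{T₀}`, `v ∈ V`,
`β ≥ 0` monotone. Then for every `φ ∈ H`, every `T` with `0 < T ≤ T₀` and every `p`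
differentiable on `I_T` with `p(0) ≥ ‖φ‖²` and `p' > 2β(p)` on `I_T` there is a solution
`u ∈ C_w(I_T; H)` of `dₜ⟪i v, u⟫ = -B t u v` (`v ∈ V`), `u(0) = φ` (`IsFormSolution`), with
`‖u(t)‖² ≤ p(t)` on `I_T`. Proof: `KatoLai1984_thmA_holds` for
`AdmissibleTriplet.ofDenseInclusion i` and `A = riesz B`.
[cite: KatoLai1984, §3 Thm A (p. 18) with Remark (b) (p. 19); canonical triplet, p. 18] -/
theorem thmA_form (i : V →L[ℝ] H) (hi : Function.Injective i) (hd : DenseRange i) {T₀ : ℝ}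
    {B : ℝ → H → V →L[ℝ] ℝ} {β : ℝ → ℝ} (hB : IsSeqWeaklyContinuousFormOn (Icc 0 T₀) B)
    (hβ : Monotone β) (hβ0 : ∀ r, 0 ≤ β r)
    (hcoercive : ∀ t ∈ Icc 0 T₀, ∀ v : V, -β (‖i v‖ ^ 2) ≤ B t (i v) v)
    (φ : H) {T : ℝ} (hT : 0 < T) (hTT₀ : T ≤ T₀) {p p' : ℝ → ℝ}
    (hp : ∀ t ∈ Icc 0 T, HasDerivWithinAt p (p' t) (Icc 0 T) t) (hp0 : ‖φ‖ ^ 2 ≤ p 0)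
    (hsuper : ∀ t ∈ Icc 0 T, 2 * β (p t) < p' t) :
    ∃ u : ℝ → H, IsFormSolution i B φ T u ∧ ∀ t ∈ Icc 0 T, ‖u t‖ ^ 2 ≤ p t := by
  set 𝒯 := AdmissibleTriplet.ofDenseInclusion i hi hd with h𝒯
  have hA : IsSeqWeaklyContinuousOn (Icc 0 T₀) (riesz B) := isSeqWeaklyContinuousOn_riesz hB
  have hcoer : ∀ t ∈ Icc 0 T₀, ∀ v : V,
      -β (‖𝒯.inclVH v‖ ^ 2) ≤ 𝒯.pairing v (riesz B t (𝒯.inclVH v)) := by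
    intro t ht v
    simp only [h𝒯, AdmissibleTriplet.ofDenseInclusion_inclVH,
      AdmissibleTriplet.ofDenseInclusion_pairing, inner_riesz]
    exact hcoercive t ht v
  obtain ⟨u, hu, hbound⟩ := KatoLai1984_thmA_holds V H V 𝒯 T₀ (riesz B) β hA hβ hβ0 hcoer φ T hT
    hTT₀ p p' hp hp0 hsuper
  exact ⟨u, IsFormSolution.of_isSolution hi hd hu, hbound⟩

/-- **Kato–Lai 1984, Theorem A in duality form, printed conclusion**: under the hypotheses of
`thmA_form` with `T₀ > 0`, for every `φ ∈ H` there are `T ∈ (0, T₀]` and a solution in duality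
form on `I_T` with `‖u(t)‖² ≤ ‖φ‖² + (2β(‖φ‖² + 1) + 1) t` (`T` and the bound depend only on `β`
and `‖φ‖_H`). [cite: KatoLai1984, §3 Thm A (p. 18)] -/
theorem thmA_form_exists (i : V →L[ℝ] H) (hi : Function.Injective i) (hd : DenseRange i)
    {T₀ : ℝ} (hT₀ : 0 < T₀) {B : ℝ → H → V →L[ℝ] ℝ} {β : ℝ → ℝ}
    (hB : IsSeqWeaklyContinuousFormOn (Icc 0 T₀) B) (hβ : Monotone β) (hβ0 : ∀ r, 0 ≤ β r)
    (hcoercive : ∀ t ∈ Icc 0 T₀, ∀ v : V, -β (‖i v‖ ^ 2) ≤ B t (i v) v) (φ : H) :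
    ∃ T : ℝ, 0 < T ∧ T ≤ T₀ ∧ ∃ u : ℝ → H, IsFormSolution i B φ T u ∧
      ∀ t ∈ Icc 0 T, ‖u t‖ ^ 2 ≤ ‖φ‖ ^ 2 + (2 * β (‖φ‖ ^ 2 + 1) + 1) * t := by
  set 𝒯 := AdmissibleTriplet.ofDenseInclusion i hi hd with h𝒯
  have hA : IsSeqWeaklyContinuousOn (Icc 0 T₀) (riesz B) := isSeqWeaklyContinuousOn_riesz hB
  have hcoer : ∀ t ∈ Icc 0 T₀, ∀ v : V,
      -β (‖𝒯.inclVH v‖ ^ 2) ≤ 𝒯.pairing v (riesz B t (𝒯.inclVH v)) := by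
    intro t ht v
    simp only [h𝒯, AdmissibleTriplet.ofDenseInclusion_inclVH,
      AdmissibleTriplet.ofDenseInclusion_pairing, inner_riesz]
    exact hcoercive t ht v
  obtain ⟨T, hT, hTT₀, u, hu, hbound⟩ :=
    KatoLai1984_thmA.exists_solution KatoLai1984_thmA_holds 𝒯 hT₀ hA hβ hβ0 hcoer φ
  exact ⟨T, hT, hTT₀, u, IsFormSolution.of_isSolution hi hd hu, hbound⟩

end ThmA

end KatoLai

end Literature.Analysis.FluidPDE

end
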